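import Summits.AtomisticToContinuum.HydrodynamicLimit.Theorems.ImplosionDichotomyPolynomialCompressionReferenceJetsIsentropic
import Summits.AtomisticToContinuum.HydrodynamicLimit.Theorems.ImplosionDichotomyPolynomialCompressionShadowingDefsHigher
import Summits.AtomisticToContinuum.HydrodynamicLimit.Theorems.ImplosionDichotomyPolynomialCompressionIsentropicCalculus
import Summits.AtomisticToContinuum.HydrodynamicLimit.Theorems.ImplosionDichotomyPolynomialCompressionLevel3Defs
import Summits.AtomisticToContinuum.HydrodynamicLimit.Theorems.ImplosionDichotomyPolynomialCompressionAtomBounds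
import Summits.AtomisticToContinuum.HydrodynamicLimit.Theorems.ImplosionDichotomyPolynomialCompressionLevel3CoefficientEnvelopeAux
import Summits.AtomisticToContinuum.HydrodynamicLimit.Theorems.ImplosionDichotomyPolynomialCompressionSubTopBounds

/-!
# The common third-order envelope of the level-3 coefficient functions (line `log-lipschitz-budget`, stub 4)

Helper file for the crux `ImplosionDichotomy.PolynomialCompression` (stmt-AtomisticToContinuum-12587), stub
`stub_logBudgetShadowing` (level-3 estimate). Discharges the pointwise envelope hypotheses of
`level3_pairing_bound` / `level3_pointwise_balance`: in the weak bootstrap regime, at a time `t` with reference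
envelope `R ≥ R₀(t)` (`shadow_reference_envelope`), every coefficient function of the thrice-differentiated
difference system has `Torus.HasDerivBoundsAt₃` at every `x` with ONE constant
`M = κ ((1 + C_b)(1 + K + K⁻¹) R (1 + (T₁ - t)⁻¹))^a`, sizes `S₂ = 18R + q(x)`, `S₃ = 54R + n(x)` (`q, n` the total
second/third derivative sizes of `δV` at `x`), and the equation-of-state forcings with the small constant `cZ σ³ M`;
the weights `A, ρ, B` lie in `[M⁻¹, M]`. (From `shadow_atom_bounds`, `shadow_reference_envelope(_weights)`, the
isentropic calculus and the closure lemmas of `TorusDerivSizeBounds`.)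
-/

noncomputable section

namespace Summit.AtomisticToContinuum.HydrodynamicLimit.Theorems

open Set MeasureTheory
open Literature.MathematicalPhysics.KineticTheory Literature.Analysis.FunctionSpaces
open scoped ContDiff

/-! ### Torus-side helpers -/

/-- Sizes of orders two and three are subadditive under `F = G + (F - G)`: with `|∂²G|, |∂³G| ≤ R` at `x`,
`dsize₂ F ≤ 9R + dsize₂ (F - G)`, `dsize₃ F ≤ 27R + dsize₃ (F - G)`, and termwise. [folklore] -/
private theorem l3ce_dsize {F G : T3 → ℝ} (hF : Torus.IsSmooth F) (hG : Torus.IsSmooth G) {x : T3} {R : ℝ}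
    (h2 : ∀ a b, |Torus.partialDeriv b (Torus.partialDeriv a G) x| ≤ R)
    (h3 : ∀ a b c, |Torus.partialDeriv c (Torus.partialDeriv b (Torus.partialDeriv a G)) x| ≤ R) :
    Torus.dsize₂ F x ≤ 9 * R + Torus.dsize₂ (fun y => F y - G y) x ∧
    Torus.dsize₃ F x ≤ 27 * R + Torus.dsize₃ (fun y => F y - G y) x ∧
    (∀ a b, |Torus.partialDeriv b (Torus.partialDeriv a F) x| ≤ R + Torus.dsize₂ (fun y => F y - G y) x) ∧
    (∀ a b c, |Torus.partialDeriv c (Torus.partialDeriv b (Torus.partialDeriv a F)) x| ≤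
      R + Torus.dsize₃ (fun y => F y - G y) x) := by
  obtain ⟨-, -, hsub2, hsub3, -⟩ := partialDeriv_iter_sum_sub
  have p2 : ∀ a b, |Torus.partialDeriv b (Torus.partialDeriv a F) x| ≤
      R + |Torus.partialDeriv b (Torus.partialDeriv a (fun y => F y - G y)) x| := fun a b => by
    have e : Torus.partialDeriv b (Torus.partialDeriv a F) x = Torus.partialDeriv b (Torus.partialDeriv a G) x +
        Torus.partialDeriv b (Torus.partialDeriv a (fun y => F y - G y)) x := by
      rw [hsub2 hF hG a b x]; ring
    rw [e]
    exact (abs_add_le _ _).trans (add_le_add (h2 a b) le_rfl)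
  have p3 : ∀ a b c, |Torus.partialDeriv c (Torus.partialDeriv b (Torus.partialDeriv a F)) x| ≤
      R + |Torus.partialDeriv c (Torus.partialDeriv b (Torus.partialDeriv a (fun y => F y - G y))) x| :=
    fun a b c => by
    have e : Torus.partialDeriv c (Torus.partialDeriv b (Torus.partialDeriv a F)) x =
        Torus.partialDeriv c (Torus.partialDeriv b (Torus.partialDeriv a G)) x +
        Torus.partialDeriv c (Torus.partialDeriv b (Torus.partialDeriv a (fun y => F y - G y))) x := by
      rw [hsub3 hF hG a b c x]; ring
    rw [e]
    exact (abs_add_le _ _).trans (add_le_add (h3 a b c) le_rfl)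
  refine ⟨?_, ?_, fun a b => (p2 a b).trans (add_le_add le_rfl (Torus.abs_partialDeriv₂_le_dsize₂ _ x a b)),
    fun a b c => (p3 a b c).trans (add_le_add le_rfl (Torus.abs_partialDeriv₃_le_dsize₃ _ x a b c))⟩
  · unfold Torus.dsize₂
    calc ∑ a, ∑ b, |Torus.partialDeriv b (Torus.partialDeriv a F) x|
          ≤ ∑ a, ∑ b, (R + |Torus.partialDeriv b (Torus.partialDeriv a (fun y => F y - G y)) x|) :=
            Finset.sum_le_sum fun a _ => Finset.sum_le_sum fun b _ => p2 a b
      _ = 9 * R + ∑ a, ∑ b, |Torus.partialDeriv b (Torus.partialDeriv a (fun y => F y - G y)) x| := by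
            simp only [Finset.sum_add_distrib, Finset.sum_const, Finset.card_univ, Fintype.card_fin]
            ring
  · unfold Torus.dsize₃
    calc ∑ a, ∑ b, ∑ c, |Torus.partialDeriv c (Torus.partialDeriv b (Torus.partialDeriv a F)) x|
          ≤ ∑ a, ∑ b, ∑ c, (R + |Torus.partialDeriv c (Torus.partialDeriv b (Torus.partialDeriv a
              (fun y => F y - G y))) x|) :=
            Finset.sum_le_sum fun a _ => Finset.sum_le_sum fun b _ => Finset.sum_le_sum fun c _ => p3 a b c
      _ = 27 * R + ∑ a, ∑ b, ∑ c, |Torus.partialDeriv c (Torus.partialDeriv b (Torus.partialDeriv a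
              (fun y => F y - G y))) x| := by
            simp only [Finset.sum_add_distrib, Finset.sum_const, Finset.card_univ, Fintype.card_fin]
            ring

/-- A function whose jets of orders `0–3` at `x` are bounded by `R` has `HasDerivBoundsAt₃` with constant `R`
and any nonnegative sizes. [folklore] -/
private theorem l3ce_ref {f : T3 → ℝ} {x : T3} {R S₂ S₃ : ℝ} (h0 : |f x| ≤ R)
    (h1 : ∀ a, |Torus.partialDeriv a f x| ≤ R) (h2 : ∀ a b, |Torus.partialDeriv b (Torus.partialDeriv a f) x| ≤ R)
    (h3 : ∀ a b c, |Torus.partialDeriv c (Torus.partialDeriv b (Torus.partialDeriv a f)) x| ≤ R)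
    (hS₂ : 0 ≤ S₂) (hS₃ : 0 ≤ S₃) : Torus.HasDerivBoundsAt₃ f x R S₂ S₃ where
  zero := h0
  one := h1
  two a b := (h2 a b).trans (le_mul_of_one_le_right ((abs_nonneg _).trans h0) (by linarith))
  three a b c := (h3 a b c).trans (le_mul_of_one_le_right ((abs_nonneg _).trans h0) (by linarith))

/-- Sums over `Fin 3` of smooth functions with third-order bounds (constant `C + C + C`), and their
smoothness. [folklore] -/
private theorem l3ce_sum3 {F : Fin 3 → T3 → ℝ} {x : T3} {C S₂ S₃ : ℝ} (hs : ∀ i, Torus.IsSmooth (F i))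
    (h : ∀ i, Torus.HasDerivBoundsAt₃ (F i) x C S₂ S₃) :
    Torus.IsSmooth (fun y => ∑ i, F i y) ∧ Torus.HasDerivBoundsAt₃ (fun y => ∑ i, F i y) x (C + C + C) S₂ S₃ := by
  have e : (fun y => ∑ i, F i y) = fun y => (F 0 y + F 1 y) + F 2 y := by
    funext y; simp only [Fin.sum_univ_three]
  rw [e]
  have hs01 : Torus.IsSmooth (fun y => F 0 y + F 1 y) := ContDiff.add (hs 0) (hs 1)
  exact ⟨ContDiff.add hs01 (hs 2),
    (hasDerivBoundsAt₃_add_sub hs01 (hs 2) (hasDerivBoundsAt₃_add_sub (hs 0) (hs 1) (h 0) (h 1)).1 (h 2)).1⟩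

/-- Coordinates of derivatives of vector fields: `|∂ₐ(vⱼ) x - ∂ₐ(v'ⱼ) x| ≤ ‖∂ₐv x - ∂ₐv' x‖` and
`|∂ₐ(vⱼ) x| ≤ ‖∂ₐ v x‖`. [folklore] -/
private theorem l3ce_coord {v v' : T3 → V3} (hv : Torus.IsSmooth v) (hv' : Torus.IsSmooth v') (a j : Fin 3)
    (x : T3) :
    |Torus.partialDeriv a (fun y => v y j) x - Torus.partialDeriv a (fun y => v' y j) x| ≤
      ‖Torus.partialDeriv a v x - Torus.partialDeriv a v' x‖ ∧
    |Torus.partialDeriv a (fun y => v y j) x| ≤ ‖Torus.partialDeriv a v x‖ := by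
  rw [Torus.partialDeriv_apply_coord (hv.isContDiff (by simp)),
    Torus.partialDeriv_apply_coord (hv'.isContDiff (by simp)), ← PiLp.sub_apply, ← Real.norm_eq_abs,
    ← Real.norm_eq_abs]
  exact ⟨PiLp.norm_apply_le _ j, PiLp.norm_apply_le _ j⟩

/-! ### The envelope -/

/-- **Coefficient envelope at level 3** (see the module docstring). [folklore] -/
theorem level3_coefficient_envelope :
    ∃ (κ : ℝ) (a : ℕ), 0 < κ ∧
      ∀ {σ T T₁ K C Cb cZ cl pl : ℝ} {Cpoly ppoly : ℕ → ℝ} {ρ θ ρ₁ θ₁ : ℝ → T3 → ℝ} {u u₁ : ℝ → T3 → V3}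
        {ζ : ℝ → ℝ} {J : Set ℝ},
        IsHardSphereEulerSolution σ T ρ u θ → IsHardSphereEulerSolution 0 T ρ₁ u₁ θ₁ →
        0 < σ → σ ≤ 1 → T ≤ T₁ → 0 < K → 0 ≤ C → 0 ≤ Cb → 0 ≤ cZ → 0 < cl →
        IsOpen J → ContDiffOn ℝ (⊤ : ℕ∞) ζ J → (∀ t ∈ Ico 0 T, ∀ x, ρ t x ∈ J) →
        (∀ t ∈ Ico 0 T, ∀ x, |ζ (ρ t x) - 1| ≤ cZ * (ρ t x * σ ^ 3) ∧
          |ρ t x * deriv ζ (ρ t x)| ≤ cZ * (ρ t x * σ ^ 3) ∧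
          |ρ t x ^ 2 * deriv (deriv ζ) (ρ t x)| ≤ cZ * (ρ t x * σ ^ 3)) →
        ShadowEosHigher cZ σ T ρ ζ →
        (∀ t ∈ Ico 0 T, ∀ x, θ₁ t x = K * ρ₁ t x ^ (2 / 3 : ℝ)) →
        (∀ t ∈ Ico 0 T, ∀ x, ∀ i : Fin 3,
          ‖Torus.partialDeriv i (u₁ t) x‖ ≤ C / (T₁ - t) ∧
          |Torus.partialDeriv i (fun y => ρ₁ t y ^ (1 / 3 : ℝ)) x| ≤ C / (T₁ - t)) →
        (∀ n : ℕ, n ≤ 6 → ∀ t ∈ Ico 0 T, ∀ y : EuclideanSpace ℝ (Fin 3),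
          ‖iteratedFDeriv ℝ n (Torus.lift (ρ₁ t)) y‖ ≤ Cpoly n * (T₁ - t) ^ (-ppoly n) ∧
          ‖iteratedFDeriv ℝ n (Torus.lift (u₁ t)) y‖ ≤ Cpoly n * (T₁ - t) ^ (-ppoly n)) →
        (∀ t ∈ Ico 0 T, ∀ x, cl * (T₁ - t) ^ pl ≤ ρ₁ t x) →
        (∀ t ∈ Ico 0 T, ∀ x, |ρ t x - ρ₁ t x| ≤ ρ₁ t x / 2 ∧ |θ t x - θ₁ t x| ≤ θ₁ t x / 2 ∧
          ρ t x * σ ^ 3 * (cZ + 1) ≤ 1 / 8) →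
        (∀ t ∈ Ico 0 T, ∀ x, ∀ i : Fin 3,
          ‖Torus.partialDeriv i (u t) x - Torus.partialDeriv i (u₁ t) x‖ ≤ Cb / (T₁ - t) ∧
          Real.sqrt (θ₁ t x) *
              |Torus.partialDeriv i (ρ t) x - Torus.partialDeriv i (ρ₁ t) x| / ρ₁ t x ≤ Cb / (T₁ - t) ∧
          |Torus.partialDeriv i (θ t) x - Torus.partialDeriv i (θ₁ t) x| / Real.sqrt (θ₁ t x) ≤ Cb / (T₁ - t)) →
        ∀ {t : ℝ}, t ∈ Ico 0 T → ∀ {R : ℝ},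
          576 * (1 + K) * (1 + ∑ n ∈ Finset.range 7, Cpoly n * (T₁ - t) ^ (-ppoly n)) ^ 5 *
              (1 + (cl * (T₁ - t) ^ pl)⁻¹) ^ 5 ≤ R →
          ∀ {Mv : ℝ}, κ * ((1 + Cb) * (1 + K + K⁻¹) * R * (1 + (T₁ - t)⁻¹)) ^ a ≤ Mv →
          ∀ x : T3,
          (Mv⁻¹ ≤ θ t x * (ζ (ρ t x) + ρ t x * deriv ζ (ρ t x)) / ρ t x ∧
            θ t x * (ζ (ρ t x) + ρ t x * deriv ζ (ρ t x)) / ρ t x ≤ Mv ∧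
            Mv⁻¹ ≤ ρ t x ∧ ρ t x ≤ Mv ∧ Mv⁻¹ ≤ 3 / 2 * ρ t x / θ t x ∧ 3 / 2 * ρ t x / θ t x ≤ Mv ∧
            l3Ws ζ ρ θ t x ≤ Mv) ∧
          Level3Coeff ζ ρ θ ρ₁ θ₁ u u₁ t x Mv (cZ * σ ^ 3 * Mv) (18 * R + l3q ρ θ ρ₁ θ₁ u u₁ t x)
            (54 * R + l3n ρ θ ρ₁ θ₁ u u₁ t x) := by
  refine ⟨2 ^ 18 * 3 ^ 16, 32, by positivity, ?_⟩
  intro σ T T₁ K C Cb cZ cl pl Cpoly ppoly ρ θ ρ₁ θ₁ u u₁ ζ J hE hE₁ hσ _hσ1 hT hK _hC hCb hcZ hcl hJ hζ hρJ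
    hEos hEosH hisen _hTI hR hF hB0 hB1 t ht R hRle Mv hMv x
  -- name the absorbing constant `b` at once (no `linarith` may see the 32nd power of a product)
  obtain ⟨b, hbdef⟩ : ∃ b : ℝ, b = (1 + Cb) * (1 + K + K⁻¹) * R * (1 + (T₁ - t)⁻¹) := ⟨_, rfl⟩
  rw [← hbdef] at hMv
  -- the reference envelope and the absorbing constants `b`, `U = 2b²`
  have hlam : 0 < T₁ - t := by linarith [ht.2]
  have hW := fun y => shadow_reference_envelope_weights hE₁ hK.le hcl hT hR hF ht hRle y
  have hJt := fun y => shadow_reference_jets hE₁ hK.le hcl hT hisen hR hF ht hRle y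
  have h1R : 1 ≤ R := (hW x 0 0 0 0).1.1
  have hR0 : 0 ≤ R := by linarith
  obtain ⟨hb1, hbR, hbKR, hbRK, hbC1, hbC2, hbu, hb3, hb4, hRU⟩ := level3_envelope_absorb hCb hK h1R hlam hbdef
  obtain ⟨U, hUdef⟩ : ∃ U : ℝ, U = 2 * b ^ 2 := ⟨_, rfl⟩
  rw [← hUdef] at hb3 hb4 hbu hRU
  have hU1 : 1 ≤ U := by rw [hUdef]; linarith [one_le_pow₀ (M₀ := ℝ) (n := 2) hb1]
  have hU0 : 0 < U := by linarith
  have hMvW : 2 ^ 18 * (1 + U) ^ 16 ≤ Mv := by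
    refine le_trans ?_ hMv
    have h : (1 + U) ^ 16 ≤ (3 * b ^ 2) ^ 16 := pow_le_pow_left₀ (by linarith) hb3 16
    calc (2 : ℝ) ^ 18 * (1 + U) ^ 16 ≤ 2 ^ 18 * (3 * b ^ 2) ^ 16 := mul_le_mul_of_nonneg_left h (by positivity)
      _ = 2 ^ 18 * 3 ^ 16 * b ^ 32 := by ring
  -- uniform pointwise facts at time `t`
  have hpt : ∀ y, (U⁻¹ ≤ ρ t y ∧ ρ t y ≤ U) ∧ |θ t y| ≤ U ∧ (∀ i, |Torus.partialDeriv i (ρ t) y| ≤ U) ∧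
      (∀ i, |Torus.partialDeriv i (θ t) y| ≤ U) ∧
      (|ζ (ρ t y) - 1| ≤ cZ * σ ^ 3 * U ^ 3 ∧ |deriv ζ (ρ t y)| ≤ cZ * σ ^ 3 * U ^ 3 ∧
        |deriv (deriv ζ) (ρ t y)| ≤ cZ * σ ^ 3 * U ^ 3 ∧
        |deriv (deriv (deriv ζ)) (ρ t y)| ≤ cZ * σ ^ 3 * U ^ 3 ∧
        |deriv (deriv (deriv (deriv ζ))) (ρ t y)| ≤ cZ * σ ^ 3 * U ^ 3) ∧
      cZ * σ ^ 3 ≤ U / 8 := fun y => by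
    obtain ⟨⟨-, -, hρ₁pos, -, -, hcR, hρi, hmi, -, -⟩, -, -, -⟩ := hW y 0 0 0 0
    obtain ⟨⟨hρ₁0, hρ₁1, -, -, -⟩, ⟨hθ₁0, hθ₁1, -, -, -⟩, -⟩ := hJt y
    obtain ⟨hc0, hρ₁c, hθ₁c, hsq⟩ := isentropic_pointwise_algebra hK hρ₁pos (hisen t ht y)
    obtain ⟨hδρ, hδθ, hpack⟩ := hB0 t ht y
    obtain ⟨hE0, hE1, hE2⟩ := hEos t ht y
    obtain ⟨hE3, hE4⟩ := hEosH t ht y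
    have hθ₁nn : 0 ≤ θ₁ t y := by rw [hθ₁c]; positivity
    exact level3_envelope_point hK h1R hCb hlam hcZ (pow_nonneg hσ.le 3) hc0 hcR hρ₁c hsq
      (inv_le_of_inv_le₀ hρ₁pos (hρi.trans hmi)) ((le_abs_self _).trans hρ₁0) hθ₁nn
      ((le_abs_self _).trans hθ₁0) hδρ hδθ hpack hE0 hE1 hE2 hE3 hE4 hρ₁1 hθ₁1
      (fun i => (hB1 t ht y i).2.1) (fun i => (hB1 t ht y i).2.2) hbR hbC1 hbC2 hUdef
  -- smoothness of the slices and of the composites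
  have hρs : Torus.IsSmooth (ρ t) := hE.smooth_density.isSmooth_slice ht
  have hθs : Torus.IsSmooth (θ t) := hE.smooth_temperature.isSmooth_slice ht
  have hus : Torus.IsSmooth (u t) := hE.smooth_velocity.isSmooth_slice ht
  have hρ₁s : Torus.IsSmooth (ρ₁ t) := hE₁.smooth_density.isSmooth_slice ht
  have hθ₁s : Torus.IsSmooth (θ₁ t) := hE₁.smooth_temperature.isSmooth_slice ht
  have hu₁s : Torus.IsSmooth (u₁ t) := hE₁.smooth_velocity.isSmooth_slice ht
  have hρpos : ∀ y, 0 < ρ t y := hE.density_pos t ht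
  have hρ₁pos : ∀ y, 0 < ρ₁ t y := hE₁.density_pos t ht
  have hinvs : ContDiffOn ℝ ∞ (Inv.inv : ℝ → ℝ) (Ioi 0) := (contDiffOn_inv ℝ).mono fun _ hs => ne_of_gt hs
  have hsinv : Torus.IsSmooth (fun y => (ρ t y)⁻¹) :=
    Torus.IsSmooth.comp_of_contDiffOn (φ := Inv.inv) hinvs hρs hρpos
  have hsinv₁ : Torus.IsSmooth (fun y => (ρ₁ t y)⁻¹) :=
    Torus.IsSmooth.comp_of_contDiffOn (φ := Inv.inv) hinvs hρ₁s hρ₁pos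
  have hsζ : Torus.IsSmooth (fun y => ζ (ρ t y)) := Torus.IsSmooth.comp_of_contDiffOn hζ hρs (hρJ t ht)
  have hsζ1 : Torus.IsSmooth (fun y => ζ (ρ t y) - 1) :=
    Torus.IsSmooth.comp_of_contDiffOn (hζ.sub contDiffOn_const) hρs (hρJ t ht)
  have hsdζ : Torus.IsSmooth (fun y => deriv ζ (ρ t y)) :=
    Torus.IsSmooth.comp_of_contDiffOn (Torus.contDiffOn_deriv_of_isOpen hζ hJ) hρs (hρJ t ht)
  have hsγ : Torus.IsSmooth (fun y => ζ (ρ t y) + ρ t y * deriv ζ (ρ t y)) :=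
    ContDiff.add hsζ (ContDiff.mul hρs hsdζ)
  have hsγ1 : Torus.IsSmooth (fun y => ζ (ρ t y) + ρ t y * deriv ζ (ρ t y) - 1) :=
    ContDiff.sub hsγ contDiff_const
  -- reference jets at `x`
  obtain ⟨⟨-, hρ₁1, hρ₁2, hρ₁3, hρ₁4⟩, ⟨hθ₁0, hθ₁1, hθ₁2, hθ₁3, hθ₁4⟩, hu₁j⟩ := hJt x
  have hinv0 : |(ρ₁ t x)⁻¹| ≤ R := by
    obtain ⟨⟨-, -, -, -, -, -, hρi, hmi, -, -⟩, -⟩ := hW x 0 0 0 0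
    rw [abs_of_pos (inv_pos.2 (hρ₁pos x))]
    exact hρi.trans hmi
  have hinv1 : ∀ i, |Torus.partialDeriv i (fun y => (ρ₁ t y)⁻¹) x| ≤ R := fun i => (hW x i 0 0 0).2.2.1.1
  have hinv2 : ∀ i j, |Torus.partialDeriv i (Torus.partialDeriv j (fun y => (ρ₁ t y)⁻¹)) x| ≤ R :=
    fun i j => (hW x i j 0 0).2.2.1.2.1
  have hinv3 : ∀ i j k,
      |Torus.partialDeriv i (Torus.partialDeriv j (Torus.partialDeriv k (fun y => (ρ₁ t y)⁻¹))) x| ≤ R :=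
    fun i j k => (hW x i j k 0).2.2.1.2.2.1
  -- the sizes
  have hsum2 : 0 ≤ ∑ i, Torus.dsize₂ (fun y => u t y i - u₁ t y i) x :=
    Finset.sum_nonneg fun i _ => Torus.dsize₂_nonneg _ _
  have hsum3 : 0 ≤ ∑ i, Torus.dsize₃ (fun y => u t y i - u₁ t y i) x :=
    Finset.sum_nonneg fun i _ => Torus.dsize₃_nonneg _ _
  have hq0 : 0 ≤ l3q ρ θ ρ₁ θ₁ u u₁ t x :=
    add_nonneg (add_nonneg (Torus.dsize₂_nonneg _ _) (Torus.dsize₂_nonneg _ _)) hsum2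
  have hn0 : 0 ≤ l3n ρ θ ρ₁ θ₁ u u₁ t x :=
    add_nonneg (add_nonneg (Torus.dsize₃_nonneg _ _) (Torus.dsize₃_nonneg _ _)) hsum3
  obtain ⟨S₂, hS₂def⟩ : ∃ S : ℝ, S = 18 * R + l3q ρ θ ρ₁ θ₁ u u₁ t x := ⟨_, rfl⟩
  obtain ⟨S₃, hS₃def⟩ : ∃ S : ℝ, S = 54 * R + l3n ρ θ ρ₁ θ₁ u u₁ t x := ⟨_, rfl⟩
  rw [← hS₂def, ← hS₃def]
  have hS₂0 : 0 ≤ S₂ := by rw [hS₂def]; positivity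
  have hS₃0 : 0 ≤ S₃ := by rw [hS₃def]; positivity
  have hqρ : Torus.dsize₂ (fun y => ρ t y - ρ₁ t y) x ≤ l3q ρ θ ρ₁ θ₁ u u₁ t x := by
    unfold l3q; linarith [Torus.dsize₂_nonneg (fun y => θ t y - θ₁ t y) x]
  have hqθ : Torus.dsize₂ (fun y => θ t y - θ₁ t y) x ≤ l3q ρ θ ρ₁ θ₁ u u₁ t x := by
    unfold l3q; linarith [Torus.dsize₂_nonneg (fun y => ρ t y - ρ₁ t y) x]
  have hnρ : Torus.dsize₃ (fun y => ρ t y - ρ₁ t y) x ≤ l3n ρ θ ρ₁ θ₁ u u₁ t x := by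
    unfold l3n; linarith [Torus.dsize₃_nonneg (fun y => θ t y - θ₁ t y) x]
  have hnθ : Torus.dsize₃ (fun y => θ t y - θ₁ t y) x ≤ l3n ρ θ ρ₁ θ₁ u u₁ t x := by
    unfold l3n; linarith [Torus.dsize₃_nonneg (fun y => ρ t y - ρ₁ t y) x]
  obtain ⟨hdρ2, hdρ3, -, -⟩ := l3ce_dsize hρs hρ₁s (x := x) (R := R) (fun a b => hρ₁2 b a)
    (fun a b c => hρ₁3 c b a)
  obtain ⟨hdθ2, hdθ3, -, -⟩ := l3ce_dsize hθs hθ₁s (x := x) (R := R) (fun a b => hθ₁2 b a)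
    (fun a b c => hθ₁3 c b a)
  have hρS₂ : Torus.dsize₂ (ρ t) x ≤ S₂ := by rw [hS₂def]; linarith
  have hθS₂ : Torus.dsize₂ (θ t) x ≤ S₂ := by rw [hS₂def]; linarith
  have hρS₃ : Torus.dsize₃ (ρ t) x ≤ S₃ := by rw [hS₃def]; linarith
  have hθS₃ : Torus.dsize₃ (θ t) x ≤ S₃ := by rw [hS₃def]; linarith
  -- the atoms of the σ-solution
  have hε0 : 0 ≤ cZ * σ ^ 3 * U ^ 3 := by positivity
  obtain ⟨Hρ, -, Hinv, Hζ, Hζ1, -, Hγ, Hγ1, HA, Hθζ⟩ :=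
    shadow_atom_bounds (x := x) (ρm := U⁻¹) (ρM := U) (θM := U) (M₁ := U)
      (z₀ := cZ * σ ^ 3 * U ^ 3) (z₁ := cZ * σ ^ 3 * U ^ 3) (z₂ := cZ * σ ^ 3 * U ^ 3)
      (z₃ := cZ * σ ^ 3 * U ^ 3) (z₄ := cZ * σ ^ 3 * U ^ 3) (S₂ := S₂) (S₃ := S₃)
      hρs hθs hJ hζ (hρJ t ht) (inv_pos.2 hU0) (fun y => (hpt y).1) (fun y => (hpt y).2.1) hU0.le
      (fun y i => (hpt y).2.2.1 i) (fun y i => (hpt y).2.2.2.1 i) hε0 hε0 hε0 hε0 hε0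
      (fun y => (hpt y).2.2.2.2.1) hρS₂ hθS₂ hρS₃ hθS₃
  -- the reference atoms
  have Hdρ₁ : ∀ j, Torus.HasDerivBoundsAt₃ (fun y => Torus.partialDeriv j (ρ₁ t) y) x R S₂ S₃ := fun j =>
    l3ce_ref (hρ₁1 j) (fun a => hρ₁2 a j) (fun a b => hρ₁3 b a j) (fun a b c => hρ₁4 c b a j) hS₂0 hS₃0
  have Hdθ₁ : ∀ j, Torus.HasDerivBoundsAt₃ (fun y => Torus.partialDeriv j (θ₁ t) y) x R S₂ S₃ := fun j =>
    l3ce_ref (hθ₁1 j) (fun a => hθ₁2 a j) (fun a b => hθ₁3 b a j) (fun a b c => hθ₁4 c b a j) hS₂0 hS₃0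
  have Hdu₁ : ∀ i j, Torus.HasDerivBoundsAt₃ (fun y => Torus.partialDeriv i (fun z => u₁ t z j) y) x R S₂ S₃ :=
    fun i j => by
    obtain ⟨-, h1, h2, h3, h4⟩ := hu₁j j
    exact l3ce_ref (h1 i) (fun a => h2 a i) (fun a b => h3 b a i) (fun a b c => h4 c b a i) hS₂0 hS₃0
  have Hθ₁ : Torus.HasDerivBoundsAt₃ (θ₁ t) x R S₂ S₃ :=
    l3ce_ref hθ₁0 hθ₁1 (fun a b => hθ₁2 b a) (fun a b c => hθ₁3 c b a) hS₂0 hS₃0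
  have Hinv₁ : Torus.HasDerivBoundsAt₃ (fun y => (ρ₁ t y)⁻¹) x R S₂ S₃ :=
    l3ce_ref hinv0 hinv1 (fun a b => hinv2 b a) (fun a b c => hinv3 c b a) hS₂0 hS₃0
  obtain ⟨hsdiv, Hdiv⟩ := l3ce_sum3 (F := fun i y => Torus.partialDeriv i (fun z => u₁ t z i) y) (x := x)
    (fun i => (hu₁s.apply i).partialDeriv i) (fun i => Hdu₁ i i)
  -- the constants
  obtain ⟨c1, cA, cζ, cθζ, c3R, cR, cG1, cG2, cH1, c1', cU, cU2, cE1, cE2⟩ :=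
    level3_envelope_consts (z := cZ * σ ^ 3 * U ^ 3) hU1 hR0 hRU (mul_nonneg hcZ (pow_nonneg hσ.le 3))
      (hpt x).2.2.2.2.2 rfl hMvW _ _ _ rfl rfl rfl
  -- the weights at `x`
  obtain ⟨⟨-, -, hρ₁px, -, -, hcRx, -, -, hcix, hm3x⟩, -, -, -⟩ := hW x 0 0 0 0
  obtain ⟨hc0x, hρ₁cx, hθ₁cx, -⟩ := isentropic_pointwise_algebra hK hρ₁px (hisen t ht x)
  obtain ⟨hδρx, hδθx, hpackx⟩ := hB0 t ht x
  obtain ⟨hE0x, hE1x, -⟩ := hEos t ht x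
  have hcZρ : cZ * (ρ t x * σ ^ 3) ≤ 1 / 8 := by
    have e : ρ t x * σ ^ 3 * (cZ + 1) = cZ * (ρ t x * σ ^ 3) + ρ t x * σ ^ 3 := by ring
    rw [e] at hpackx
    linarith [mul_nonneg (hρpos x).le (pow_nonneg hσ.le 3)]
  refine ⟨level3_envelope_weights hK h1R (inv_le_of_inv_le₀ hc0x (hcix.trans hm3x)) hcRx hρ₁cx hθ₁cx hδρx hδθx
    (hE0x.trans hcZρ) (hE1x.trans hcZρ) hbR hbKR hbRK (hb4.trans cU2), ?_⟩
  -- the coefficient envelope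
  have Hρ' := Hρ.mono c1 hS₂0 hS₃0
  unfold Level3Coeff
  refine ⟨fun i a => ?_, fun i a b => ?_, fun i a b c => ?_, Hρ'.one, Hρ'.two, Hρ'.three, HA.mono cA hS₂0 hS₃0,
    Hζ.mono cζ hS₂0 hS₃0, Hθζ.mono cθζ hS₂0 hS₃0, Hdiv.mono c3R hS₂0 hS₃0,
    fun i => (Hdρ₁ i).mono cR hS₂0 hS₃0, fun i j => (Hdu₁ i j).mono cR hS₂0 hS₃0,
    fun i => (Hdθ₁ i).mono cR hS₂0 hS₃0, fun j => ?_, fun j => ?_, ?_, fun j => ?_, ?_⟩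
  · -- `|∂ₐuᵢ| ≤ R + C_b/λ ≤ U ≤ Mv`
    have h := (l3ce_coord hus hu₁s a i x).1
    have h1 := (hB1 t ht x a).1
    have h2 := (hu₁j i).2.1 a
    have h3 := abs_add_le (Torus.partialDeriv a (fun y => u₁ t y i) x)
      (Torus.partialDeriv a (fun y => u t y i) x - Torus.partialDeriv a (fun y => u₁ t y i) x)
    rw [add_sub_cancel] at h3
    linarith
  · obtain ⟨-, -, h2, -⟩ := l3ce_dsize (hus.apply i) (hu₁s.apply i) (x := x) (R := R)
      (fun a b => (hu₁j i).2.2.1 b a) (fun a b c => (hu₁j i).2.2.2.1 c b a)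
    have hq : Torus.dsize₂ (fun y => u t y i - u₁ t y i) x ≤ l3q ρ θ ρ₁ θ₁ u u₁ t x := by
      have hs : Torus.dsize₂ (fun y => u t y i - u₁ t y i) x ≤ ∑ k, Torus.dsize₂ (fun y => u t y k - u₁ t y k) x :=
        Finset.single_le_sum (f := fun k => Torus.dsize₂ (fun y => u t y k - u₁ t y k) x)
          (fun _ _ => Torus.dsize₂_nonneg _ _) (Finset.mem_univ i)
      unfold l3q
      linarith [Torus.dsize₂_nonneg (fun y => ρ t y - ρ₁ t y) x, Torus.dsize₂_nonneg (fun y => θ t y - θ₁ t y) x]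
    have h4 : R + Torus.dsize₂ (fun y => u t y i - u₁ t y i) x ≤ 1 * (1 + S₂) := by rw [hS₂def]; linarith
    exact ((h2 a b).trans h4).trans (mul_le_mul_of_nonneg_right c1' (by linarith))
  · obtain ⟨-, -, -, h3⟩ := l3ce_dsize (hus.apply i) (hu₁s.apply i) (x := x) (R := R)
      (fun a b => (hu₁j i).2.2.1 b a) (fun a b c => (hu₁j i).2.2.2.1 c b a)
    have hn : Torus.dsize₃ (fun y => u t y i - u₁ t y i) x ≤ l3n ρ θ ρ₁ θ₁ u u₁ t x := by
      have hs : Torus.dsize₃ (fun y => u t y i - u₁ t y i) x ≤ ∑ k, Torus.dsize₃ (fun y => u t y k - u₁ t y k) x :=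
        Finset.single_le_sum (f := fun k => Torus.dsize₃ (fun y => u t y k - u₁ t y k) x)
          (fun _ _ => Torus.dsize₃_nonneg _ _) (Finset.mem_univ i)
      unfold l3n
      linarith [Torus.dsize₃_nonneg (fun y => ρ t y - ρ₁ t y) x, Torus.dsize₃_nonneg (fun y => θ t y - θ₁ t y) x]
    have h4 : R + Torus.dsize₃ (fun y => u t y i - u₁ t y i) x ≤ 1 * (1 + S₂ + S₃) := by
      rw [hS₃def]; linarith
    exact ((h3 a b c).trans h4).trans (mul_le_mul_of_nonneg_right c1' (by linarith))
  · -- `γ(ρ)/ρ ∂ⱼρ₁`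
    have e : (fun y => (ζ (ρ t y) + ρ t y * deriv ζ (ρ t y)) / ρ t y * Torus.partialDeriv j (ρ₁ t) y) =
        fun y => (ζ (ρ t y) + ρ t y * deriv ζ (ρ t y)) * (ρ t y)⁻¹ * Torus.partialDeriv j (ρ₁ t) y := by
      funext y; rw [div_eq_mul_inv]
    rw [e]
    exact ((Hγ.mul Hinv hsγ hsinv hS₂0 hS₃0).mul (Hdρ₁ j) (ContDiff.mul hsγ hsinv) (hρ₁s.partialDeriv j)
      hS₂0 hS₃0).mono cG1 hS₂0 hS₃0
  · -- `θ₁/(ρρ₁) ∂ⱼρ₁`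
    have e : (fun y => θ₁ t y / (ρ t y * ρ₁ t y) * Torus.partialDeriv j (ρ₁ t) y) =
        fun y => θ₁ t y * (ρ t y)⁻¹ * (ρ₁ t y)⁻¹ * Torus.partialDeriv j (ρ₁ t) y := by
      funext y; rw [div_eq_mul_inv, mul_inv, ← mul_assoc]
    rw [e]
    exact (((Hθ₁.mul Hinv hθ₁s hsinv hS₂0 hS₃0).mul Hinv₁ (ContDiff.mul hθ₁s hsinv) hsinv₁ hS₂0 hS₃0).mul
      (Hdρ₁ j) (ContDiff.mul (ContDiff.mul hθ₁s hsinv) hsinv₁) (hρ₁s.partialDeriv j) hS₂0 hS₃0).mono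
      cG2 hS₂0 hS₃0
  · -- `ζ(ρ) div u₁`
    exact (Hζ.mul Hdiv hsζ hsdiv hS₂0 hS₃0).mono cH1 hS₂0 hS₃0
  · -- the equation-of-state forcing of the momentum rows
    have e : (fun y => θ₁ t y * (ζ (ρ t y) + ρ t y * deriv ζ (ρ t y) - 1) / ρ t y * Torus.partialDeriv j (ρ₁ t) y +
          (ζ (ρ t y) - 1) * Torus.partialDeriv j (θ₁ t) y) =
        fun y => θ₁ t y * (ζ (ρ t y) + ρ t y * deriv ζ (ρ t y) - 1) * (ρ t y)⁻¹ * Torus.partialDeriv j (ρ₁ t) y +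
          (ζ (ρ t y) - 1) * Torus.partialDeriv j (θ₁ t) y := by
      funext y; rw [div_eq_mul_inv]
    rw [e]
    have hs1 : Torus.IsSmooth (fun y => θ₁ t y * (ζ (ρ t y) + ρ t y * deriv ζ (ρ t y) - 1) * (ρ t y)⁻¹ *
        Torus.partialDeriv j (ρ₁ t) y) :=
      ContDiff.mul (ContDiff.mul (ContDiff.mul hθ₁s hsγ1) hsinv) (hρ₁s.partialDeriv j)
    have hs2 : Torus.IsSmooth (fun y => (ζ (ρ t y) - 1) * Torus.partialDeriv j (θ₁ t) y) :=
      ContDiff.mul hsζ1 (hθ₁s.partialDeriv j)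
    exact (hasDerivBoundsAt₃_add_sub hs1 hs2
      ((((Hθ₁.mul Hγ1 hθ₁s hsγ1 hS₂0 hS₃0).mul Hinv (ContDiff.mul hθ₁s hsγ1) hsinv hS₂0 hS₃0).mul (Hdρ₁ j)
        (ContDiff.mul (ContDiff.mul hθ₁s hsγ1) hsinv) (hρ₁s.partialDeriv j) hS₂0 hS₃0))
      (Hζ1.mul (Hdθ₁ j) hsζ1 (hθ₁s.partialDeriv j) hS₂0 hS₃0)).1.mono cE1 hS₂0 hS₃0
  · -- the equation-of-state forcing of the temperature row
    exact (((Hθ₁.mul Hζ1 hθ₁s hsζ1 hS₂0 hS₃0).const_mul (ContDiff.mul hθ₁s hsζ1) (2 / 3)).mul Hdiv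
      (ContDiff.mul contDiff_const (ContDiff.mul hθ₁s hsζ1)) hsdiv hS₂0 hS₃0).mono cE2 hS₂0 hS₃0

end Summit.AtomisticToContinuum.HydrodynamicLimit.Theorems

end
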